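/-
Copyright (c) 2026. All rights reserved.
Released under Apache 2.0 license as described in the file LICENSE.
Authors: HodgeCM publication cell (pub-hodgecm), DAG-node prover lineage #14 (gen 6: statements and proofs;
gen 7: tree port).
-/
import Literature.Analysis.Distribution.SchwartzOfRealSlope
import Mathlib.Analysis.SpecialFunctions.Trigonometric.DerivHyp
import HarnessLib

/-!
# Hyperbolic one-parameter groups `exp(sJ) = cosh s · 1 + sinh s · J` (`J² = 1`) on Schwartz space

Topic `Analysis/Distribution`; namespace `Literature.Analysis.Distribution`.  For ANY continuous linear
`J : E → E` with `J * J = 1` on a real normed space `E`, `exp(sJ) = cosh s · 1 + sinh s · J` is a one-parameter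
group of continuous linear automorphisms; this file makes it a named object (`coshSinhCLM J s`,
`involFlow J hJ s : E ≃L[ℝ] E`; group law `involFlow_add_apply` from the addition formulas for `cosh`, `sinh`;
operator-norm derivative `J` at `0`, `hasDerivAt_coe_involFlow`) and instantiates the general smooth-vector
theorems of `SchwartzLinearFlowDeriv`, `SchwartzFlowSmooth`, `SchwartzOfRealSlope` for the composition
action `Φ ↦ Φ ∘ exp(sJ)` on `𝓢(E, F)`:

* `tendsto_compCLM_involFlow_sub_div_at` — in the topology of `𝓢(E, F)`, at every base point,
  `s⁻¹ • (Φ ∘ exp((s₀+s)J) - Φ ∘ exp(s₀J)) → flowGen J (Φ ∘ exp(s₀J))` (`flowGen J Φ x = DΦ(x)[J x]`);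
* `hasDerivAt_apply_compCLM_involFlow`, `contDiff_apply_compCLM_involFlow`,
  `iteratedDeriv_apply_compCLM_involFlow` — scalar coefficients are `C^∞`;
* `tendsto_compCLM_sub_div_at_ofReal` (any linear group) and `tendsto_compCLM_involFlow_sub_div_ofReal(_at)`
  — the complex-scalar forms `((s : ℂ))⁻¹ • (…)`;
* the doubled-space example: the hyperbolic generator `hypGen V = [[0,-1],[-1,0]] ⊗ 1 : (x, y) ↦ (-y, -x)` on
  `V × V`, `hypGen_mul_hypGen`, the hyperbolic rotation
  `hypFlow V s : (x, y) ↦ (cosh s · x - sinh s · y, cosh s · y - sinh s · x)`, `flowGen_hypGen_apply`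
  (`= -DΦ(x, y)[(y, x)]`), `tendsto_compCLM_hypFlow_sub_div_ofReal`.  This is the flow of the split Cartan
  element of `SL₂(ℝ)` (resp. `O(1,1)`) acting linearly on a doubled configuration space, as it appears for
  the hyperbolic / "squeezing" one-parameter subgroups of the metaplectic representation in a Schrödinger
  model after the substitution diagonalising `x ∂_y + y ∂_x` (G. B. Folland, *Harmonic Analysis in Phase
  Space*, Ch. 4 [Folland1989]).

Design: `J` and the proof `hJ : J * J = 1` are explicit arguments of `involFlow` (no typeclass), so that
several involutions on one space coexist; the coordinate version on function spaces `ι ⊕ ι → ℝ` is the file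
`SchwartzHyperbolicFlowCoord`.  NOT here: the exponential of a general bounded generator (`SchwartzExpFlow`).

Provenance: tree port (LEAN-IN-TREE, 2026-08-18) of the HodgeCM publication cell's package file
`HodgeCM/Automorphic/SchwartzHyperbolicFlow.lean` (unit `pub-hodgecm-pv14-g6`, gate run 31; namespace
`HodgeCM.SchwartzWeil` ↦ `Literature.Analysis.Distribution`, statements verbatim).  Nothing in this file is
specific to that cell or under adjudication there; in particular no identification of any particular model
operator with this flow is asserted here.
-/

set_option autoImplicit false

noncomputable section

open Filter Topology
open scoped SchwartzMap ContDiff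

namespace Literature.Analysis.Distribution

/-! ## `exp(sJ)` for an involutive generator -/

section Involutive

variable {E : Type*} [NormedAddCommGroup E] [NormedSpace ℝ E] (J : E →L[ℝ] E)

/-- `exp(sJ) = cosh s · 1 + sinh s · J` as a continuous linear map (valid when `J² = 1`). [folklore] -/
def coshSinhCLM (s : ℝ) : E →L[ℝ] E := Real.cosh s • 1 + Real.sinh s • J

/-- `coshSinhCLM J s x = cosh s • x + sinh s • J x`. [folklore] -/
theorem coshSinhCLM_apply (s : ℝ) (x : E) : coshSinhCLM J s x = Real.cosh s • x + Real.sinh s • J x := by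
  simp [coshSinhCLM]

/-- `coshSinhCLM J 0 = 1`. [folklore] -/
theorem coshSinhCLM_zero : coshSinhCLM J 0 = 1 := by
  simp [coshSinhCLM]

/-- The group law `exp((s+t)J) = exp(sJ) exp(tJ)` from the addition formulas and `J² = 1`. [folklore] -/
theorem coshSinhCLM_add (hJ : J * J = 1) (s t : ℝ) :
    coshSinhCLM J (s + t) = coshSinhCLM J s * coshSinhCLM J t := by
  simp only [coshSinhCLM, Real.cosh_add, Real.sinh_add, mul_add, add_mul, smul_mul_smul_comm, mul_one,
    one_mul, hJ, add_smul]
  abel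

/-- The one-parameter group `s ↦ exp(sJ)` of continuous linear automorphisms (inverse `exp(-sJ)`). [folklore] -/
def involFlow (hJ : J * J = 1) (s : ℝ) : E ≃L[ℝ] E :=
  ContinuousLinearEquiv.unitsEquiv ℝ E
    ⟨coshSinhCLM J s, coshSinhCLM J (-s),
      by rw [← coshSinhCLM_add J hJ, add_neg_cancel, coshSinhCLM_zero],
      by rw [← coshSinhCLM_add J hJ, neg_add_cancel, coshSinhCLM_zero]⟩

variable (hJ : J * J = 1)

/-- As a continuous linear map, `involFlow J hJ s = coshSinhCLM J s`. [folklore] -/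
theorem coe_involFlow (s : ℝ) : ((involFlow J hJ s : E ≃L[ℝ] E) : E →L[ℝ] E) = coshSinhCLM J s := by
  ext x
  rfl

/-- `involFlow J hJ s x = cosh s • x + sinh s • J x`. [folklore] -/
@[simp] theorem involFlow_apply (s : ℝ) (x : E) :
    involFlow J hJ s x = Real.cosh s • x + Real.sinh s • J x := by
  rw [show involFlow J hJ s x = coshSinhCLM J s x from rfl, coshSinhCLM_apply]

/-- `involFlow J hJ 0 = 1`. [folklore] -/
theorem coe_involFlow_zero : ((involFlow J hJ 0 : E ≃L[ℝ] E) : E →L[ℝ] E) = 1 := by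
  rw [coe_involFlow, coshSinhCLM_zero]

/-- The group law `exp((s+t)J) x = exp(sJ) (exp(tJ) x)`. [folklore] -/
theorem involFlow_add_apply (s t : ℝ) (x : E) :
    involFlow J hJ (s + t) x = involFlow J hJ s (involFlow J hJ t x) := by
  show coshSinhCLM J (s + t) x = coshSinhCLM J s (coshSinhCLM J t x)
  rw [coshSinhCLM_add J hJ]
  rfl

/-- The operator-norm derivative of `s ↦ exp(sJ)` at `0` is `J`. [folklore] -/
theorem hasDerivAt_coe_involFlow :
    HasDerivAt (fun s => ((involFlow J hJ s : E ≃L[ℝ] E) : E →L[ℝ] E)) J 0 := by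
  have h := ((Real.hasDerivAt_cosh 0).smul_const (1 : E →L[ℝ] E)).add
    ((Real.hasDerivAt_sinh 0).smul_const J)
  rw [Real.sinh_zero, Real.cosh_zero, zero_smul, one_smul, zero_add] at h
  refine h.congr_of_eventuallyEq (Eventually.of_forall fun s => ?_)
  exact coe_involFlow J hJ s

end Involutive

/-! ## The flow on Schwartz space -/

section Schwartz

variable {E F G : Type*} [NormedAddCommGroup E] [NormedSpace ℝ E] [NormedAddCommGroup F]
  [NormedSpace ℝ F] [NormedAddCommGroup G] [NormedSpace ℝ G]
variable (𝕜 : Type*) [RCLike 𝕜] [NormedSpace 𝕜 F] [SMulCommClass ℝ 𝕜 F]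
variable (J : E →L[ℝ] E) (hJ : J * J = 1)

/-- **`exp(sJ)` is differentiable in the Schwartz topology, at every base point**:
`s⁻¹ • (Φ ∘ exp((s₀+s)J) - Φ ∘ exp(s₀J)) → flowGen J (Φ ∘ exp(s₀J))` in `𝓢(E, F)`. [folklore] -/
theorem tendsto_compCLM_involFlow_sub_div_at (Φ : 𝓢(E, F)) (s₀ : ℝ) :
    Tendsto (fun s : ℝ => s⁻¹ • (SchwartzMap.compCLMOfContinuousLinearEquiv 𝕜 (involFlow J hJ (s₀ + s)) Φ
        - SchwartzMap.compCLMOfContinuousLinearEquiv 𝕜 (involFlow J hJ s₀) Φ)) (𝓝[≠] 0)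
      (𝓝 (flowGen J (SchwartzMap.compCLMOfContinuousLinearEquiv 𝕜 (involFlow J hJ s₀) Φ))) :=
  tendsto_compCLM_sub_div_at 𝕜 (coe_involFlow_zero J hJ) (hasDerivAt_coe_involFlow J hJ)
    (involFlow_add_apply J hJ) Φ s₀

/-- Every scalar coefficient `s ↦ T (Φ ∘ exp(sJ))` is differentiable, with derivative
`T (flowGen J (Φ ∘ exp(s₀J)))`. [folklore] -/
theorem hasDerivAt_apply_compCLM_involFlow (T : 𝓢(E, F) →L[ℝ] G) (Φ : 𝓢(E, F)) (s₀ : ℝ) :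
    HasDerivAt (fun s => T (SchwartzMap.compCLMOfContinuousLinearEquiv 𝕜 (involFlow J hJ s) Φ))
      (T (flowGen J (SchwartzMap.compCLMOfContinuousLinearEquiv 𝕜 (involFlow J hJ s₀) Φ))) s₀ :=
  hasDerivAt_apply_compCLM 𝕜 T (coe_involFlow_zero J hJ) (hasDerivAt_coe_involFlow J hJ)
    (involFlow_add_apply J hJ) Φ s₀

/-- Every scalar coefficient `s ↦ T (Φ ∘ exp(sJ))` is `C^∞` on `ℝ`. [folklore] -/
theorem contDiff_apply_compCLM_involFlow (T : 𝓢(E, F) →L[ℝ] G) (Φ : 𝓢(E, F)) :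
    ContDiff ℝ ∞ (fun s : ℝ => T (SchwartzMap.compCLMOfContinuousLinearEquiv 𝕜 (involFlow J hJ s) Φ)) :=
  contDiff_apply_compCLM 𝕜 T (coe_involFlow_zero J hJ) (hasDerivAt_coe_involFlow J hJ)
    (involFlow_add_apply J hJ) Φ

/-- Its iterated derivatives: `(d/ds)^k T (Φ ∘ exp(sJ)) = T ((flowGen J)^k (Φ ∘ exp(sJ)))`. [folklore] -/
theorem iteratedDeriv_apply_compCLM_involFlow (T : 𝓢(E, F) →L[ℝ] G) (Φ : 𝓢(E, F)) (k : ℕ) :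
    iteratedDeriv k (fun s : ℝ => T (SchwartzMap.compCLMOfContinuousLinearEquiv 𝕜 (involFlow J hJ s) Φ))
      = fun s => T ((flowGen J)^[k]
          (SchwartzMap.compCLMOfContinuousLinearEquiv 𝕜 (involFlow J hJ s) Φ)) :=
  iteratedDeriv_apply_compCLM 𝕜 T (coe_involFlow_zero J hJ) (hasDerivAt_coe_involFlow J hJ)
    (involFlow_add_apply J hJ) Φ k

end Schwartz

/-! ## Complex-scalar forms -/

section Complex

variable {E F : Type*} [NormedAddCommGroup E] [NormedSpace ℝ E] [NormedAddCommGroup F]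
  [NormedSpace ℝ F] [NormedSpace ℂ F] [IsScalarTower ℝ ℂ F] [SMulCommClass ℝ ℂ F]
variable {L : ℝ → E ≃L[ℝ] E} {A : E →L[ℝ] E}

/-- **Linear one-parameter groups at every base point, complex scalars**:
`((s : ℂ))⁻¹ • (Φ ∘ L (s₀+s) - Φ ∘ L s₀) → flowGen A (Φ ∘ L s₀)` in `𝓢(E, F)`. [folklore] -/
theorem tendsto_compCLM_sub_div_at_ofReal (hL0 : ((L 0 : E ≃L[ℝ] E) : E →L[ℝ] E) = 1)
    (hL : HasDerivAt (fun s => ((L s : E ≃L[ℝ] E) : E →L[ℝ] E)) A 0)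
    (hmul : ∀ s t x, L (s + t) x = L s (L t x)) (Φ : 𝓢(E, F)) (s₀ : ℝ) :
    Tendsto (fun s : ℝ => ((s : ℂ))⁻¹ • (SchwartzMap.compCLMOfContinuousLinearEquiv ℂ (L (s₀ + s)) Φ
        - SchwartzMap.compCLMOfContinuousLinearEquiv ℂ (L s₀) Φ)) (𝓝[≠] 0)
      (𝓝 (flowGen A (SchwartzMap.compCLMOfContinuousLinearEquiv ℂ (L s₀) Φ))) :=
  tendsto_ofReal_inv_smul_iff.2 (tendsto_compCLM_sub_div_at ℂ hL0 hL hmul Φ s₀)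

variable (J : E →L[ℝ] E) (hJ : J * J = 1)

/-- **`exp(sJ)` with complex scalars, at every base point.** [folklore] -/
theorem tendsto_compCLM_involFlow_sub_div_ofReal_at (Φ : 𝓢(E, F)) (s₀ : ℝ) :
    Tendsto (fun s : ℝ => ((s : ℂ))⁻¹
        • (SchwartzMap.compCLMOfContinuousLinearEquiv ℂ (involFlow J hJ (s₀ + s)) Φ
          - SchwartzMap.compCLMOfContinuousLinearEquiv ℂ (involFlow J hJ s₀) Φ)) (𝓝[≠] 0)
      (𝓝 (flowGen J (SchwartzMap.compCLMOfContinuousLinearEquiv ℂ (involFlow J hJ s₀) Φ))) :=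
  tendsto_compCLM_sub_div_at_ofReal (coe_involFlow_zero J hJ) (hasDerivAt_coe_involFlow J hJ)
    (involFlow_add_apply J hJ) Φ s₀

/-- **`exp(sJ)` with complex scalars at `0`** — the literal shape of a smooth-vector clause
`((s : ℂ))⁻¹ • (ω(s)v - v) → X v`: `((s : ℂ))⁻¹ • (Φ ∘ exp(sJ) - Φ) → flowGen J Φ`. [folklore] -/
theorem tendsto_compCLM_involFlow_sub_div_ofReal (Φ : 𝓢(E, F)) :
    Tendsto (fun s : ℝ => ((s : ℂ))⁻¹
        • (SchwartzMap.compCLMOfContinuousLinearEquiv ℂ (involFlow J hJ s) Φ - Φ)) (𝓝[≠] 0)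
      (𝓝 (flowGen J Φ)) :=
  tendsto_compCLM_sub_div_ofReal (coe_involFlow_zero J hJ) (hasDerivAt_coe_involFlow J hJ) Φ

end Complex

/-! ## The doubled-space example `X₁ : (x, y) ↦ (-y, -x)` on `V × V` -/

section Doubled

variable (V : Type*) [NormedAddCommGroup V] [NormedSpace ℝ V]

/-- The hyperbolic generator `X₁ = [[0,-1],[-1,0]] ⊗ 1 : (x, y) ↦ (-y, -x)` on `V × V`. [folklore] -/
def hypGen : (V × V) →L[ℝ] (V × V) :=
  -((ContinuousLinearMap.snd ℝ V V).prod (ContinuousLinearMap.fst ℝ V V))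

/-- `hypGen V (x, y) = (-y, -x)`. [folklore] -/
@[simp] theorem hypGen_apply (p : V × V) : hypGen V p = (-p.2, -p.1) := by
  simp [hypGen]

/-- `X₁² = 1`. [folklore] -/
theorem hypGen_mul_hypGen : hypGen V * hypGen V = 1 := by
  ext p <;> simp

/-- The hyperbolic rotation `exp(s X₁)` of `V × V`. [folklore] -/
def hypFlow (s : ℝ) : (V × V) ≃L[ℝ] (V × V) := involFlow (hypGen V) (hypGen_mul_hypGen V) s

/-- `hypFlow V s (x, y) = (cosh s • x - sinh s • y, cosh s • y - sinh s • x)`. [folklore] -/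
@[simp] theorem hypFlow_apply (s : ℝ) (p : V × V) :
    hypFlow V s p = (Real.cosh s • p.1 - Real.sinh s • p.2, Real.cosh s • p.2 - Real.sinh s • p.1) := by
  refine Prod.ext ?_ ?_ <;> simp [hypFlow, sub_eq_add_neg]

variable {V}
variable {F : Type*} [NormedAddCommGroup F] [NormedSpace ℝ F]

/-- The generator on Schwartz space: `flowGen X₁ Φ (x, y) = -DΦ(x, y)[(y, x)]`. [folklore] -/
theorem flowGen_hypGen_apply (Φ : 𝓢(V × V, F)) (p : V × V) :
    flowGen (hypGen V) Φ p = -(fderiv ℝ (Φ : V × V → F) p (p.2, p.1)) := by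
  rw [flowGen_apply, hypGen_apply, show ((-p.2, -p.1) : V × V) = -(p.2, p.1) from rfl, map_neg]

variable [NormedSpace ℂ F] [IsScalarTower ℝ ℂ F] [SMulCommClass ℝ ℂ F]

/-- **The hyperbolic rotation flow on `𝓢(V × V, F)` with complex scalars at `0`**:
`((s : ℂ))⁻¹ • (Φ ∘ hypFlow s - Φ) → flowGen X₁ Φ`. [folklore] -/
theorem tendsto_compCLM_hypFlow_sub_div_ofReal (Φ : 𝓢(V × V, F)) :
    Tendsto (fun s : ℝ => ((s : ℂ))⁻¹
        • (SchwartzMap.compCLMOfContinuousLinearEquiv ℂ (hypFlow V s) Φ - Φ)) (𝓝[≠] 0)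
      (𝓝 (flowGen (hypGen V) Φ)) :=
  tendsto_compCLM_involFlow_sub_div_ofReal (hypGen V) (hypGen_mul_hypGen V) Φ

end Doubled

end Literature.Analysis.Distribution
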